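import Summits.BirchSwinnertonDyer.BirchSwinnertonDyer.Theorems.GenusKolyvaginAtTwoMinimalTwinBSDTwoKrizLiAnchor43a1
import Literature.NumberTheory.EllipticCurves.Curve37aRootNumber
import HarnessLib

/-!
# Route `GenusKolyvaginAtTwo`, crux U₂ `MinimalTwinBSDTwo` (stmt-BirchSwinnertonDyer-22985), LINE 23 «twin_swap»: THE ROOT NUMBER OF THE RANK-ONE ANCHOR `43a1`
# IS `−1` (NON-split multiplicative reduction at the single bad prime `43`), HENCE `ord_{s=1} L(43a1, s) = 1` MODULO MODULARITY + Kriz–Li Thm 4.3 — the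
# Gross–Zagier–Kolyvagin input (`rank_eq_analyticRank_of_analyticRank_le_one`) of the road `…KrizLiAnchor43a1.lean` DISCHARGED: the rank-one members of the `43a1`
# packet are U₂-class curves settled from PRINT (Kriz–Li + Creutz–Miller) + MODULARITY ALONE

Seat `bsd-line-gk2-p2` g36 (PROVER 2/3, cell `bsd-f1-sign2`; LINE 23 holder), `--supports stmt-BirchSwinnertonDyer-22985` (helper; closes nothing).
THEOREMS ONLY (0 `def`, 0 `sorry`); standard axioms.  HONEST FRAMING (D-0014/D-0036): the method and lemma names are those of the tree's
`Literature/…/Curve37aRootNumber.lean` (`37a`: non-split place at `37`) and of this seat's `…KrizLiAnchor37b1RootNumber.lean` (g35), transplanted to Cremona's `43A1`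
(`⟨0, 1, 1, 0, 0⟩`, `Δ = −43`, `c₄ = 16`, `N = 43`): at `v ∤ 43` the discriminant is a `v`-unit (good reduction, `W_v = +1`); at the place above `43`, `c₄ = 16` is a
unit (Bezout `3·43 − 8·16 = 1`) and `v(Δ) < 1`, so the reduction is multiplicative, and NON-split: Mathlib's node-tangent quadratic
`c₄T² + a₁c₄T − (54b₆ − 3b₂b₄ + a₂c₄) = 16T² − 70` has NO root over `κ(O_v) = 𝔽₄₃` — a root `r` would make `(16r)² = 16·70 = 1120` a square mod `43`, but
`(1120 | 43) = −1` — i.e. `a_43(43a1) = −1`, so `W_43 = +1` (Rohrlich) and the algebraic root number `−∏_v W_v = −1`; by the Modularity Theorem (`exists_isNewformOf`) and the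
tree's PROVED Atkin–Lehner comparison for squarefree conductor (`rootNumber_eq_algebraicRootNumber_of_squarefree`), `w(43a1) = −1`; the unconditional half of parity
(`odd_analyticRank_of_rootNumber_eq_neg_one`) makes `r_an` odd, and Kriz–Li Thm 4.3 with the Table-1 (★)-datum (`krizLi_analyticRank_le_one`) caps it at `1`:
**`r_an(43a1) = 1`** — Cremona's Table 1 entry `r = 1` as a theorem modulo PRINT + MODULARITY, with NO Gross–Zagier–Kolyvagin input (§3).  §4 re-issues the U₂ sorting of
`…KrizLiAnchor43a1.lean` with `hmod` in place of `hGZK`: `printFamily43A1_krizLi_rankOneMembers_of_modularity` etc.  **BSD is NOT proved by any of this; U₂ is NOT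
proved; no item is closed.**

References: [CremonaAlgorithms1997] Table 1 (curve 43A1: `r = 1`), §2.11, Appendix to Ch. II; [SilvermanAEC2009] VII.5 Prop. 5.1, C.16 Thm. 16.3; [Rohrlich1993Compositio]
Prop. 2; [KrizLi2019] Thm 4.3, §6 Table 1 (row 43a1); [BCDTJAMS2001] Thm. A; [KellockDokchitser2023] Cor. 2.5.
-/

set_option autoImplicit false
-- the Theorems namespace of this sub repeats the summit name by design (D-0017 nested layout)
set_option linter.dupNamespace false

noncomputable section

open scoped Classical

open IsDedekindDomain IsDedekindDomain.HeightOneSpectrum WeierstrassCurve Polynomial NumberField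
  Literature.NumberTheory.EllipticCurves
  Literature.NumberTheory.EllipticCurves.ModularForms
  Literature.NumberTheory.EllipticCurves.Rank1Residual
  Literature.NumberTheory.EllipticCurves.Rank1Residual.Typed
  Summit.BirchSwinnertonDyer.Rank1Residual
  Summit.BirchSwinnertonDyer.Rank1Residual.P2
  Summit.BirchSwinnertonDyer.BirchSwinnertonDyer.Theorems.AddPotGoodPrint

namespace Summit.BirchSwinnertonDyer.BirchSwinnertonDyer.Theorems.GenusExact.TwinSwap.KrizLiAnchor43a1

/-! ## §1 Invariants of the equation over `ℚ` -/
section Invariants43A1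

/-- `Δ(43a1) = −43` (rational model). [cite: CremonaAlgorithms1997, Table 1 (43A1)] -/
theorem Δ_43A1 : (⟨0, 1, 1, 0, 0⟩ : WeierstrassCurve ℚ).Δ = -43 := by
  norm_num [WeierstrassCurve.Δ, WeierstrassCurve.b₂, WeierstrassCurve.b₄, WeierstrassCurve.b₆, WeierstrassCurve.b₈]

/-- `c₄(43a1) = 16` (rational model). [cite: CremonaAlgorithms1997, Table 1 (43A1)] -/
theorem c₄_43A1 : (⟨0, 1, 1, 0, 0⟩ : WeierstrassCurve ℚ).c₄ = 16 := by
  norm_num [WeierstrassCurve.c₄, WeierstrassCurve.b₂, WeierstrassCurve.b₄]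

/-- `43a1` is integral at every finite place of `ℤ`. [cite: SilvermanAEC2009, VIII.8] -/
theorem isIntegralAt_43A1 (v : HeightOneSpectrum ℤ) : (⟨0, 1, 1, 0, 0⟩ : WeierstrassCurve ℚ).IsIntegralAt v := by
  rw [isIntegralAt_iff_valuation_le_one]
  refine ⟨?_, ?_, ?_, ?_, ?_⟩ <;> simp

end Invariants43A1

/-! ## §2 Local root numbers: `+1` everywhere (good away from `43`, NON-split multiplicative above `43`); algebraic root number `−1` -/
section LocalRootNumbers43A1

/-- At a place `v` with `v(Δ) = 1` (`v ∤ 43`) the curve has good reduction, so `W_v = 1`. [cite: Rohrlich1993Compositio, Prop. 2(i)] -/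
theorem localRootNumberAt_of_valuation_Δ_eq_one_43A1 (v : HeightOneSpectrum ℤ)
    (h : v.valuation ℚ (⟨0, 1, 1, 0, 0⟩ : WeierstrassCurve ℚ).Δ = 1) :
    haveI := isElliptic_43A1
    (⟨0, 1, 1, 0, 0⟩ : WeierstrassCurve ℚ).localRootNumberAt v = 1 :=
  haveI := isElliptic_43A1
  WeierstrassCurve.localRootNumberAt_of_hasGoodReductionAt
    (hasGoodReductionAt_of_valuation_Δ_eq_one_holds v _ (isIntegralAt_43A1 v) h)

/-- If `v(Δ) < 1` then `v` is the place above `43`: `43 ∈ v` (`Δ = −43`). [folklore] -/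
theorem mem_of_valuation_Δ_lt_one_43A1 {v : HeightOneSpectrum ℤ}
    (h : v.valuation ℚ (⟨0, 1, 1, 0, 0⟩ : WeierstrassCurve ℚ).Δ < 1) : (43 : ℤ) ∈ v.asIdeal := by
  rw [Δ_43A1] at h
  have h' : v.valuation ℚ (algebraMap ℤ ℚ 43) < 1 := by
    have : (-43 : ℚ) = -(algebraMap ℤ ℚ 43) := by norm_num
    rw [this, Valuation.map_neg] at h
    exact h
  exact (v.valuation_lt_one_iff_mem (43 : ℤ)).mp h'

/-- `16 ∉ v` when `43 ∈ v` (Bezout: `3·43 − 8·16 = 1`). [folklore] -/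
theorem not_mem_c₄_43A1 {v : HeightOneSpectrum ℤ} (hp : (43 : ℤ) ∈ v.asIdeal) :
    (16 : ℤ) ∉ v.asIdeal := by
  intro hc
  have hone : (1 : ℤ) ∈ v.asIdeal := by
    have := v.asIdeal.add_mem (v.asIdeal.mul_mem_left 3 hp) (v.asIdeal.mul_mem_left (-8) hc)
    convert this using 1
    norm_num
  exact v.isPrime.ne_top ((Ideal.eq_top_iff_one _).mpr hone)

/-- At the place above `43`, `c₄ = 16` is a `v`-unit. [cite: SilvermanAEC2009, VII.5 Prop. 5.1(b)] -/
theorem valuation_c₄_eq_one_43A1 {v : HeightOneSpectrum ℤ} (hp : (43 : ℤ) ∈ v.asIdeal) :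
    v.valuation ℚ (⟨0, 1, 1, 0, 0⟩ : WeierstrassCurve ℚ).c₄ = 1 := by
  rw [c₄_43A1]
  by_contra h
  have h' : v.valuation ℚ (algebraMap ℤ ℚ 16) ≠ 1 := by simpa using h
  have hlt := lt_of_le_of_ne (v.valuation_le_one (16 : ℤ)) h'
  exact not_mem_c₄_43A1 hp ((v.valuation_lt_one_iff_mem (16 : ℤ)).mp hlt)

/-- At the place above `43` the reduction is multiplicative (`v(c₄) = 1`, `v(Δ) < 1`). [cite: SilvermanAEC2009, VII.5 Prop. 5.1(b)] -/
theorem hasMultiplicativeReductionAt_43A1 {v : HeightOneSpectrum ℤ}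
    (h : v.valuation ℚ (⟨0, 1, 1, 0, 0⟩ : WeierstrassCurve ℚ).Δ < 1) :
    haveI := isElliptic_43A1
    (⟨0, 1, 1, 0, 0⟩ : WeierstrassCurve ℚ).HasMultiplicativeReductionAt v :=
  haveI := isElliptic_43A1
  hasMultiplicativeReductionAt_of_valuation_c₄_eq_one (isIntegralAt_43A1 v)
    (valuation_c₄_eq_one_43A1 (mem_of_valuation_Δ_lt_one_43A1 h)) h

/-- The arithmetic heart: if `43 ∈ v` (a proper ideal of `ℤ`) and `16 r² − 70 ∈ v` for an integer `r`, then `1120 = 16 · 70 = (16 r)²` is a square in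
`ZMod 43` — impossible, the Jacobi symbol `(1120 | 43) = (2 | 43)⁵ (5 | 43) (7 | 43)` being `−1`. [folklore] -/
theorem no_int_root_43A1 {v : HeightOneSpectrum ℤ} (hp : (43 : ℤ) ∈ v.asIdeal) (r : ℤ)
    (hr : 16 * r ^ 2 - 70 ∈ v.asIdeal) : False := by
  -- `43 ∣ 16 r² − 70`, since otherwise `gcd = 1 ∈ v`
  have hdvd : (43 : ℤ) ∣ 16 * r ^ 2 - 70 := by
    by_contra hnd
    have hP : Prime (43 : ℤ) := Int.prime_iff_natAbs_prime.mpr (by norm_num)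
    obtain ⟨a, b, hab⟩ := (hP.coprime_iff_not_dvd).mpr hnd
    have hone : (1 : ℤ) ∈ v.asIdeal := by
      rw [← hab]
      exact v.asIdeal.add_mem (v.asIdeal.mul_mem_left a hp) (v.asIdeal.mul_mem_left b hr)
    exact v.isPrime.ne_top ((Ideal.eq_top_iff_one _).mpr hone)
  have hz : ((16 * r ^ 2 - 70 : ℤ) : ZMod 43) = 0 :=
    (ZMod.intCast_zmod_eq_zero_iff_dvd _ 43).mpr (by exact_mod_cast hdvd)
  push_cast at hz
  have hsq : IsSquare ((1120 : ℤ) : ZMod 43) := by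
    refine ⟨((16 * r : ℤ) : ZMod 43), ?_⟩
    push_cast
    linear_combination (-16 : ZMod 43) * hz
  exact ZMod.nonsquare_of_jacobiSym_eq_neg_one (a := 1120) (b := 43) (by norm_num) hsq

/-- **NON-split multiplicative reduction at `43`.** For the place `v` above `43`, the chosen local minimal model of `43a1` does not have split multiplicative
reduction: the node-tangent quadratic `16 T² − 70` of the integral model has no root in `κ(O_v) = 𝔽₄₃` (equivalently `a_43(43a1) = −1`; Cremona Table 1: `43A1` has
`r = 1`, `w = −1 = −a_43`). [cite: CremonaAlgorithms1997, Table 1 (43A1) and §2.11] -/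
theorem not_hasSplitMultiplicativeReductionAt_43A1 {v : HeightOneSpectrum ℤ}
    (h : v.valuation ℚ (⟨0, 1, 1, 0, 0⟩ : WeierstrassCurve ℚ).Δ < 1) :
    haveI := isElliptic_43A1
    ¬ (⟨0, 1, 1, 0, 0⟩ : WeierstrassCurve ℚ).HasSplitMultiplicativeReductionAt v := by
  haveI := isElliptic_43A1
  have hp := mem_of_valuation_Δ_lt_one_43A1 h
  have hc₄ := valuation_c₄_eq_one_43A1 hp
  have hW := isIntegralAt_43A1 v
  set O := v.adicCompletionIntegers ℚ with hO
  set K := v.adicCompletion ℚ with hK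
  set EK := (⟨0, 1, 1, 0, 0⟩ : WeierstrassCurve ℚ).baseChange K with hEK
  haveI hmin : EK.IsMinimal O :=
    isMinimalAt_of_lt_valuation_c₄ hW
      (by rw [hc₄, ← WithZero.exp_zero]; exact WithZero.exp_lt_exp.mpr (by norm_num))
  haveI : EK.IsElliptic := by rw [hEK, WeierstrassCurve.baseChange]; infer_instance
  obtain ⟨Dv, hD⟩ : ∃ Dv : VariableChange K, (⟨0, 1, 1, 0, 0⟩ : WeierstrassCurve ℚ).localMinimalModel v = Dv • EK := ⟨_, rfl⟩
  unfold WeierstrassCurve.HasSplitMultiplicativeReductionAt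
  rw [hasSplitMultiplicativeReduction_iff_of_isMinimal_of_eq_smul O hD EK.isUnit_Δ.ne_zero,
    hasSplitMultiplicativeReduction_iff]
  intro hS
  obtain ⟨hm, hsplit⟩ := hS
  -- the integral model of `EK = E ⊗ K_v` has the integer coefficients of `E`
  have inj := IsFractionRing.injective O K
  have hc4 : (EK.integralModel O).c₄ = 16 := inj <| by
    rw [integralModel_c₄_eq, map_ofNat, hEK, WeierstrassCurve.baseChange, map_c₄, c₄_43A1]; norm_num
  have ha1 : (EK.integralModel O).a₁ = 0 := inj <| by
    rw [integralModel_a₁_eq, map_zero, hEK, WeierstrassCurve.baseChange, map_a₁]; simp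
  have ha2 : (EK.integralModel O).a₂ = 1 := inj <| by
    rw [integralModel_a₂_eq, map_one, hEK, WeierstrassCurve.baseChange, map_a₂]; simp
  have hb2 : (EK.integralModel O).b₂ = 4 := inj <| by
    rw [integralModel_b₂_eq, map_ofNat, hEK, WeierstrassCurve.baseChange, map_b₂]; norm_num [WeierstrassCurve.b₂]
  have hb4 : (EK.integralModel O).b₄ = 0 := inj <| by
    rw [integralModel_b₄_eq, map_zero, hEK, WeierstrassCurve.baseChange, map_b₄]; norm_num [WeierstrassCurve.b₄]
  have hb6 : (EK.integralModel O).b₆ = 1 := inj <| by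
    rw [integralModel_b₆_eq, map_one, hEK, WeierstrassCurve.baseChange, map_b₆]; norm_num [WeierstrassCurve.b₆]
  rw [hc4, ha1, ha2, hb2, hb4, hb6] at hsplit
  -- the node-tangent quadratic over `κ(O_v)` is `16 T² − 70`
  set φ : O →+* IsLocalRing.ResidueField O := algebraMap O (IsLocalRing.ResidueField O) with hφ
  have h16 : (16 : IsLocalRing.ResidueField O) ≠ 0 := by
    intro h0
    have : ((IsLocalRing.residue O).comp (algebraMap ℤ O)) 16 = 0 := by
      rw [RingHom.comp_apply, map_ofNat, map_ofNat]; exact h0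
    have hmem : (16 : ℤ) ∈ v.asIdeal := by
      rw [← ker_residue_comp_algebraMap ℚ v]; exact this
    exact not_mem_c₄_43A1 hp hmem
  have hpoly : Polynomial.map φ (C (16 : O) * X ^ 2 + C (0 * 16) * X - C (54 * 1 - 3 * 4 * 0 + 1 * 16)) =
      C (16 : IsLocalRing.ResidueField O) * X ^ 2 + C (0 : IsLocalRing.ResidueField O) * X
        + C (-70 : IsLocalRing.ResidueField O) := by
    simp only [Polynomial.map_sub, Polynomial.map_add, Polynomial.map_mul, Polynomial.map_pow,
      Polynomial.map_X, Polynomial.map_ofNat, Polynomial.map_zero, Polynomial.map_one, map_mul, map_sub, map_add,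
      map_ofNat, map_zero, map_one, map_neg]
    ring
  rw [hpoly] at hsplit
  have hdeg : (C (16 : IsLocalRing.ResidueField O) * X ^ 2 + C (0 : IsLocalRing.ResidueField O) * X
      + C (-70 : IsLocalRing.ResidueField O)).degree ≠ 0 := by
    rw [degree_quadratic h16]; decide
  obtain ⟨t, ht⟩ := hsplit.exists_eval_eq_zero hdeg
  simp only [eval_add, eval_mul, eval_C, eval_pow, eval_X, zero_mul, add_zero] at ht
  -- lift the root to an integer
  obtain ⟨r, hr⟩ := residue_comp_algebraMap_surjective ℚ v t
  have hι : ((IsLocalRing.residue O).comp (algebraMap ℤ O)) (16 * r ^ 2 - 70) = 0 := by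
    rw [map_sub, map_mul, map_pow, hr, map_ofNat, map_ofNat]
    linear_combination ht
  have hmem : (16 * r ^ 2 - 70 : ℤ) ∈ v.asIdeal := by
    rw [← ker_residue_comp_algebraMap ℚ v]; exact hι
  exact no_int_root_43A1 hp r hmem

/-- **Every local root number of `43a1` is `+1`** (good reduction away from `43`, non-split multiplicative at `43`). [cite: Rohrlich1993Compositio, Prop. 2] -/
theorem localRootNumberAt_43A1 (v : HeightOneSpectrum ℤ) :
    haveI := isElliptic_43A1
    (⟨0, 1, 1, 0, 0⟩ : WeierstrassCurve ℚ).localRootNumberAt v = 1 := by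
  haveI := isElliptic_43A1
  rcases (WeierstrassCurve.valuation_Δ_le_one_of_isIntegralAt (isIntegralAt_43A1 v)).eq_or_lt with h | h
  · exact localRootNumberAt_of_valuation_Δ_eq_one_43A1 v h
  · exact localRootNumberAt_of_hasMultiplicativeReductionAt_of_not_split
      (hasMultiplicativeReductionAt_43A1 h) (not_hasSplitMultiplicativeReductionAt_43A1 h)

/-- **The algebraic root number of `43a1` is `−1`**: `−∏ᶠ_v W_v = −1`, all local factors being `+1` and the archimedean one `−1` (Cremona Table 1: `43A1` has
rank `1`, odd). [cite: CremonaAlgorithms1997, Table 1 (43A1)] -/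
theorem algebraicRootNumber_43A1 :
    haveI := isElliptic_43A1
    (⟨0, 1, 1, 0, 0⟩ : WeierstrassCurve ℚ).algebraicRootNumber = -1 := by
  haveI := isElliptic_43A1
  rw [WeierstrassCurve.algebraicRootNumber, finprod_eq_one_of_forall_eq_one localRootNumberAt_43A1]

end LocalRootNumbers43A1

/-! ## §3 Semistability, `w(43a1) = −1` from modularity, and `r_an(43a1) = 1` -/
section RootNumber43A1

/-- The conductor `N = 43` of `43a1` is squarefree. [cite: CremonaAlgorithms1997, Table 1 (43A1)] -/
theorem squarefree_conductorNorm_43A1 :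
    haveI := isElliptic_43A1
    Squarefree ((⟨0, 1, 1, 0, 0⟩ : WeierstrassCurve ℚ).conductorNorm ℤ) := by
  rw [conductorNorm_43A1]
  exact (show Nat.Prime 43 by norm_num).squarefree

/-- **`43a1` is semistable**: good or multiplicative reduction at every finite place. [cite: SilvermanAEC2009, VII.5 Prop. 5.1] -/
theorem isSemistable_43A1 : (⟨0, 1, 1, 0, 0⟩ : WeierstrassCurve ℚ).IsSemistable ℤ := by
  haveI := isElliptic_43A1
  intro v
  have hint := isIntegralAt_43A1 v
  rcases (WeierstrassCurve.valuation_Δ_le_one_of_isIntegralAt hint).eq_or_lt with h | h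
  · exact WeierstrassCurve.isSemistableAt_of_valuation_Δ_eq_one hint h
  · exact WeierstrassCurve.isSemistableAt_of_valuation_c₄_eq_one hint (valuation_c₄_eq_one_43A1 (mem_of_valuation_Δ_lt_one_43A1 h))

/-- No place of additive reduction. [cite: SilvermanAEC2009, VII.5 Prop. 5.1] -/
theorem not_hasAdditiveReductionAt_43A1 (v : HeightOneSpectrum ℤ) :
    haveI := isElliptic_43A1
    ¬ (⟨0, 1, 1, 0, 0⟩ : WeierstrassCurve ℚ).HasAdditiveReductionAt v :=
  haveI := isElliptic_43A1
  (WeierstrassCurve.isSemistableAt_iff_not_hasAdditiveReductionAt v _).mp (isSemistable_43A1 v)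

/-- **The (analytic) root number of `43a1` is `−1`, from the Modularity Theorem alone** (tree `rootNumber_eq_algebraicRootNumber_of_squarefree`, Atkin–Lehner at
squarefree level). [cite: CremonaAlgorithms1997, Table 1 (43A1)] [cite: BCDTJAMS2001, Thm. A] [cite: KellockDokchitser2023, Cor. 2.5] -/
theorem rootNumber_43A1 (hmod : exists_isNewformOf) :
    haveI := isElliptic_43A1
    (⟨0, 1, 1, 0, 0⟩ : WeierstrassCurve ℚ).rootNumber = -1 := by
  haveI := isElliptic_43A1
  rw [(WeierstrassCurve.rootNumber_eq_algebraicRootNumber_of_squarefree _ squarefree_conductorNorm_43A1 hmod)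
    (fun v h => (not_hasAdditiveReductionAt_43A1 v h).elim), algebraicRootNumber_43A1]

/-- `ord_{s=1} L(43a1, s)` is odd, from the Modularity Theorem alone (`w = −1` and the unconditional half of parity). [cite: SilvermanAEC2009, C.16 Thm. 16.3 and remark, p. 451] -/
theorem odd_analyticRank_43A1 (hmod : exists_isNewformOf) :
    haveI := isElliptic_43A1
    Odd (⟨0, 1, 1, 0, 0⟩ : WeierstrassCurve ℚ).analyticRank :=
  haveI := isElliptic_43A1
  WeierstrassCurve.odd_analyticRank_of_rootNumber_eq_neg_one (rootNumber_43A1 hmod)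

/-- ★ **`ord_{s=1} L(43a1, s) = 1` modulo PRINT + MODULARITY, with NO Gross–Zagier–Kolyvagin input**: odd by `w = −1` (`odd_analyticRank_43A1`) and `≤ 1` by Kriz–Li
Thm 4.3 at `d = 1` over `ℚ(√−7)` with the Table-1 (★)-datum (`krizLi_analyticRank_le_one`; the field `ℚ(√−7)` is built in the kernel as `sqrtField (−7)`).  Discharges the
`hGZK` of `analyticRank_43A1` (`…KrizLiAnchor43a1.lean`): Cremona's `r = 1` for `43A1` as a theorem modulo print + modularity.
[cite: CremonaAlgorithms1997, Table 1 (43A1: r = 1)] [cite: KrizLi2019, Thm. 4.3 and §6 Table 1 (row 43a1)] -/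
theorem analyticRank_43A1_of_modularity (h33 : KrizLi2019.thm33_rank_twist) (htab : KrizLi2019.table1_row43a1) (hmod : exists_isNewformOf) :
    haveI := isElliptic_43A1
    (⟨0, 1, 1, 0, 0⟩ : WeierstrassCurve ℚ).analyticRank = 1 := by
  haveI := isElliptic_43A1; haveI := isGloballyMinimal_43A1
  haveI : Fact ((-7 : ℤ) < 0) := ⟨by norm_num⟩
  obtain ⟨hIQ, hdisc⟩ := P2.isImaginaryQuadratic_and_discr_of_sq_eq_neg_prime (sqrtField.finrank_eq_two (-7))
    (p := 7) (by norm_num) (by norm_num) (x := sqrtField.r (-7)) (by rw [sqrtField.r_sq']; push_cast; ring)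
  obtain ⟨_, Dt, H, ι, P, j, -, hP, hstar⟩ := htab (sqrtField (-7)) hIQ hdisc
  have hle := krizLi_analyticRank_le_one _ h33 twoTorsion_43A1 (sqrtField (-7)) hIQ (satisfiesHeegnerHypothesis_43A1 hIQ.1 hdisc)
    Dt H ι P hP j hstar
  obtain ⟨k, hk⟩ := odd_analyticRank_43A1 hmod
  omega

end RootNumber43A1

/-! ## §4 The U₂ sorting of the `43a1` packet with GZK DISCHARGED (modularity instead of `hGZK`) -/
section Sorting43A1

/-- ★ **THE RANK-ONE MEMBERS `43a1^{(d)}` — U₂-CLASS CURVES SETTLED BY PRINT + MODULARITY ALONE**: at every global minimal `W₁ ≅ 43a1^{(d)}` (`d ∈ 𝒩(43a1, K)`,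
`χ_d(−43) = 1`): `r_an(W₁) = 1 ∧ ¬CM ∧ BSD(W₁, 2)`; by name Kriz–Li Thm 5.1 (2), Thm 4.3, the Table-1 row, Creutz–Miller and MODULARITY — no wall row, no LINE 23 stub,
no Gross–Zagier–Kolyvagin.  BSD is not proved by any of this; U₂ is not proved. [cite: KrizLi2019, Thm. 5.1 (2), Thm. 4.3, Thm. 1.4, §6 Table 1 (row 43a1)]
[cite: CreutzMiller2012, Thm. 1.1] [cite: Miller2011LMS, Def. 1.1] [cite: CremonaAlgorithms1997, Table 1 (43A1)] -/
theorem printFamily43A1_krizLi_rankOneMembers_of_modularity (hKL : KrizLi2019.thm112_bsdTwo_twist) (h33 : KrizLi2019.thm33_rank_twist)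
    (htab : KrizLi2019.table1_row43a1) (hS31 : bsdTriple_of_analyticRank_le_one_of_conductor_lt) (hmod : exists_isNewformOf)
    (K : Type) [Field K] [NumberField K] (hK : IsImaginaryQuadratic K) (hdK : NumberField.discr K = -7)
    {d : ℤ} (hd : haveI := isGloballyMinimal_43A1; KrizLi2019.InN (⟨0, 1, 1, 0, 0⟩ : WeierstrassCurve ℚ) K d)
    (hsign : haveI := isElliptic_43A1; Int.sign d * jacobiSym ((⟨0, 1, 1, 0, 0⟩ : WeierstrassCurve ℚ).conductorNorm ℤ) d.natAbs = 1)
    (W₁ : WeierstrassCurve ℚ) [W₁.IsElliptic] [W₁.IsGloballyMinimal]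
    (hW₁ : ∃ C : VariableChange ℚ, C • (⟨0, 1, 1, 0, 0⟩ : WeierstrassCurve ℚ).quadraticTwist (d : ℚ) = W₁) :
    W₁.analyticRank = 1 ∧ ¬ W₁.HasCM ∧ BSDp W₁ 2 := by
  haveI := isElliptic_43A1; haveI := isGloballyMinimal_43A1
  have hr1 := analyticRank_43A1_of_modularity h33 htab hmod
  obtain ⟨_, Dt, H, ι, P, j, -, hP, hstar⟩ := htab K hK hdK
  have hB : BSDp W₁ 2 := krizLi_bsdp_two_of_twist_43A1 hKL h33 hS31 K hK hdK Dt H ι P hP j hstar hd hsign W₁ (Or.inl hW₁)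
  have hD : (NumberField.discr K : ℚ) ≠ 0 := by exact_mod_cast NumberField.discr_ne_zero K
  have hd0 : (d : ℚ) ≠ 0 := cast_ne_zero_of_inN _ hd
  have hdK0 : ((d * NumberField.discr K : ℤ) : ℚ) ≠ 0 := by push_cast; exact mul_ne_zero hd0 hD
  obtain ⟨W₂, _, _, hW₂⟩ := exists_globallyMinimal_twist (⟨0, 1, 1, 0, 0⟩ : WeierstrassCurve ℚ) hdK0
  obtain ⟨-, heq⟩ := krizLi_analyticRank_twists _ h33 twoTorsion_43A1 K hK (satisfiesHeegnerHypothesis_43A1 hK.1 hdK) Dt H ι P hP j hstar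
    hd hsign W₁ W₂ hW₁ hW₂
  exact ⟨by rw [heq, hr1], not_hasCM_of_smul_quadraticTwist_43A1 hd0 W₁ hW₁, hB⟩

/-- **THE RANK-ZERO COMPANIONS `43a1^{(−7d)}`**, print + modularity alone: `r_an(W₂) = 0 ∧ ¬CM ∧ BSD(W₂, 2)` at every global minimal `W₂ ≅ 43a1^{(−7d)}`
(`d ∈ 𝒩(43a1, K)`, `χ_d(−43) = 1`).  BSD is not proved by any of this. [cite: KrizLi2019, Thm. 5.1 (2), Thm. 4.3, §6 Table 1 (row 43a1)] [cite: CreutzMiller2012, Thm. 1.1]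
[cite: Miller2011LMS, Def. 1.1] -/
theorem printFamily43A1_krizLi_rankZeroCompanions_of_modularity (hKL : KrizLi2019.thm112_bsdTwo_twist) (h33 : KrizLi2019.thm33_rank_twist)
    (htab : KrizLi2019.table1_row43a1) (hS31 : bsdTriple_of_analyticRank_le_one_of_conductor_lt) (hmod : exists_isNewformOf)
    (K : Type) [Field K] [NumberField K] (hK : IsImaginaryQuadratic K) (hdK : NumberField.discr K = -7)
    {d : ℤ} (hd : haveI := isGloballyMinimal_43A1; KrizLi2019.InN (⟨0, 1, 1, 0, 0⟩ : WeierstrassCurve ℚ) K d)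
    (hsign : haveI := isElliptic_43A1; Int.sign d * jacobiSym ((⟨0, 1, 1, 0, 0⟩ : WeierstrassCurve ℚ).conductorNorm ℤ) d.natAbs = 1)
    (W₂ : WeierstrassCurve ℚ) [W₂.IsElliptic] [W₂.IsGloballyMinimal]
    (hW₂ : ∃ C : VariableChange ℚ, C • (⟨0, 1, 1, 0, 0⟩ : WeierstrassCurve ℚ).quadraticTwist ((-7 * d : ℤ) : ℚ) = W₂) :
    W₂.analyticRank = 0 ∧ ¬ W₂.HasCM ∧ BSDp W₂ 2 := by
  haveI := isElliptic_43A1; haveI := isGloballyMinimal_43A1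
  have hr1 := analyticRank_43A1_of_modularity h33 htab hmod
  obtain ⟨_, Dt, H, ι, P, j, -, hP, hstar⟩ := htab K hK hdK
  have hdK' : ((d * NumberField.discr K : ℤ) : ℚ) = ((-7 * d : ℤ) : ℚ) := by rw [hdK]; push_cast; ring
  have hW₂' : ∃ C : VariableChange ℚ, C • (⟨0, 1, 1, 0, 0⟩ : WeierstrassCurve ℚ).quadraticTwist ((d * NumberField.discr K : ℤ) : ℚ) = W₂ := by
    rw [hdK']; exact hW₂
  have hB : BSDp W₂ 2 := krizLi_bsdp_two_of_twist_43A1 hKL h33 hS31 K hK hdK Dt H ι P hP j hstar hd hsign W₂ (Or.inr hW₂')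
  have hd0 : (d : ℚ) ≠ 0 := cast_ne_zero_of_inN _ hd
  obtain ⟨W₁, _, _, hW₁⟩ := exists_globallyMinimal_twist (⟨0, 1, 1, 0, 0⟩ : WeierstrassCurve ℚ) hd0
  obtain ⟨hor, heq⟩ := krizLi_analyticRank_twists _ h33 twoTorsion_43A1 K hK (satisfiesHeegnerHypothesis_43A1 hK.1 hdK) Dt H ι P hP j hstar
    hd hsign W₁ W₂ hW₁ hW₂'
  have hr2 : W₂.analyticRank = 0 := by omega
  have hdd0 : ((-7 * d : ℤ) : ℚ) ≠ 0 := by push_cast; exact mul_ne_zero (by norm_num) hd0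
  exact ⟨hr2, not_hasCM_of_smul_quadraticTwist_43A1 hdd0 W₂ hW₂, hB⟩

/-- **The rank-one witness member `43a1^{(−11)}`** (`N = 5203`), print + modularity alone.  BSD is not proved by any of this.
[cite: KrizLi2019, Thm. 5.1 (2), Thm. 4.3, §6 Table 1 (row 43a1)] [cite: CreutzMiller2012, Thm. 1.1] -/
theorem printFamily43A1_krizLi_witness_neg11_of_modularity (hKL : KrizLi2019.thm112_bsdTwo_twist) (h33 : KrizLi2019.thm33_rank_twist)
    (htab : KrizLi2019.table1_row43a1) (hS31 : bsdTriple_of_analyticRank_le_one_of_conductor_lt) (hmod : exists_isNewformOf)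
    (K : Type) [Field K] [NumberField K] (hK : IsImaginaryQuadratic K) (hdK : NumberField.discr K = -7)
    (W₁ : WeierstrassCurve ℚ) [W₁.IsElliptic] [W₁.IsGloballyMinimal]
    (hW₁ : ∃ C : VariableChange ℚ, C • (⟨0, 1, 1, 0, 0⟩ : WeierstrassCurve ℚ).quadraticTwist ((-11 : ℤ) : ℚ) = W₁) :
    W₁.analyticRank = 1 ∧ ¬ W₁.HasCM ∧ BSDp W₁ 2 :=
  printFamily43A1_krizLi_rankOneMembers_of_modularity hKL h33 htab hS31 hmod K hK hdK (inN_neg11_43A1 hK.1 hdK) sign_neg11_43A1 W₁ hW₁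

/-- **The rank-zero witness companion `43a1^{(77)}`** (`77 = (−7)·(−11)`), print + modularity alone.  BSD is not proved by any of this.
[cite: KrizLi2019, Thm. 5.1 (2), Thm. 4.3, §6 Table 1 (row 43a1)] [cite: CreutzMiller2012, Thm. 1.1] -/
theorem printFamily43A1_krizLi_witness77_of_modularity (hKL : KrizLi2019.thm112_bsdTwo_twist) (h33 : KrizLi2019.thm33_rank_twist)
    (htab : KrizLi2019.table1_row43a1) (hS31 : bsdTriple_of_analyticRank_le_one_of_conductor_lt) (hmod : exists_isNewformOf)
    (K : Type) [Field K] [NumberField K] (hK : IsImaginaryQuadratic K) (hdK : NumberField.discr K = -7)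
    (W₂ : WeierstrassCurve ℚ) [W₂.IsElliptic] [W₂.IsGloballyMinimal]
    (hW₂ : ∃ C : VariableChange ℚ, C • (⟨0, 1, 1, 0, 0⟩ : WeierstrassCurve ℚ).quadraticTwist ((77 : ℤ) : ℚ) = W₂) :
    W₂.analyticRank = 0 ∧ ¬ W₂.HasCM ∧ BSDp W₂ 2 :=
  printFamily43A1_krizLi_rankZeroCompanions_of_modularity hKL h33 htab hS31 hmod K hK hdK (inN_neg11_43A1 hK.1 hdK) sign_neg11_43A1 W₂
    (by rw [show ((-7 * -11 : ℤ) : ℚ) = ((77 : ℤ) : ℚ) by norm_num]; exact hW₂)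

end Sorting43A1

end Summit.BirchSwinnertonDyer.BirchSwinnertonDyer.Theorems.GenusExact.TwinSwap.KrizLiAnchor43a1

end
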